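import Mathlib.Analysis.SpecificLimits.Basic
import Mathlib.Topology.Algebra.Order.Field
import Mathlib.Topology.Sequences
import Mathlib.Data.Nat.Log
import Mathlib.Order.Filter.AtTopBot.Finite
import HarnessLib

/-!
# Dyadic normal form of a mesh sequence (stub `stub_meshNormalForm` of line `Sketch`)

Crux `DyadicLatticeBetaLaw` (stmt-CriticalPhenomena-18183, route `DyadicBetaRigidity` of
`CardyFormulaZ2`), line `Sketch` (skeleton `Cruxes/DyadicLatticeBetaLaw/Lines/Sketch.lean`).
Bond-`ℤ²` crossing probabilities are exactly dilation covariant, so a general mesh sequence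
`u n → 0⁺` is reduced to DYADIC ladders by writing `u = c · 2^(-m)` with `c` in a compact window.
This file is the pure real-analysis normal form behind that reduction (registered support stub
`stub_meshNormalForm`): every sequence `u n → 0⁺` (i.e. `Tendsto u atTop (𝓝[>] 0)`) has a
subsequence `u ∘ ψ` with `u (ψ n) = c n / 2 ^ (m n)`, `m : ℕ → ℕ` strictly increasing, all
`c n ∈ [1/2, 1]`, and `c n → c₀ ∈ [1/2, 1]`.

Proof. Beyond some `N₀` one has `0 < u n ≤ 1`; for `t ∈ (0, 1]` put `k = ⌊t⁻¹⌋₊ ≥ 1` and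
`M = Nat.log 2 k` (the dyadic exponent), so `2 ^ M ≤ k ≤ t⁻¹ < k + 1 ≤ 2 ^ (M + 1)` and the
mantissa `t · 2 ^ M ∈ (1/2, 1]`. Along the (shifted) sequence `t⁻¹ → ∞`, hence `⌊t⁻¹⌋₊ → ∞` and
`M → ∞`; `Filter.strictMono_subseq_of_tendsto_atTop` extracts a subsequence with strictly
increasing exponents and Bolzano–Weierstrass (`isCompact_Icc.tendsto_subseq`) a further one along
which the mantissae converge in `[1/2, 1]`. No definition is introduced: exponent and mantissa are
carried as the explicit expressions `Nat.log 2 ⌊t⁻¹⌋₊` and `t * 2 ^ Nat.log 2 ⌊t⁻¹⌋₊`.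

References: folklore (dyadic decomposition of positive reals); context: B. Bollobás, O. Riordan,
*Percolation* (2006), Ch. 7 §7.1.
-/

noncomputable section

open Filter Set Metric Topology

namespace Summit.CriticalPhenomena.CardyFormulaZ2.Cruxes.DyadicLatticeBetaLaw.Stubs

namespace MeshNormalForm

/-- Lower dyadic bracket: `2 ^ M ≤ t⁻¹` for `0 < t ≤ 1`, `M = Nat.log 2 ⌊t⁻¹⌋₊`. [folklore] -/
theorem pow_log_floor_le_inv {t : ℝ} (ht : 0 < t) (ht1 : t ≤ 1) :
    (2 : ℝ) ^ Nat.log 2 ⌊t⁻¹⌋₊ ≤ t⁻¹ := by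
  have hk : 0 < ⌊t⁻¹⌋₊ := Nat.floor_pos.2 ((one_le_inv₀ ht).2 ht1)
  calc (2 : ℝ) ^ Nat.log 2 ⌊t⁻¹⌋₊ = ((2 ^ Nat.log 2 ⌊t⁻¹⌋₊ : ℕ) : ℝ) := by push_cast; rfl
    _ ≤ (⌊t⁻¹⌋₊ : ℝ) := by exact_mod_cast Nat.pow_log_le_self 2 hk.ne'
    _ ≤ t⁻¹ := Nat.floor_le (inv_nonneg.2 ht.le)

/-- Upper dyadic bracket: `t⁻¹ < 2 ^ (M + 1)` for every real `t`, `M = Nat.log 2 ⌊t⁻¹⌋₊`.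
[folklore] -/
theorem inv_lt_pow_log_floor_succ (t : ℝ) : t⁻¹ < (2 : ℝ) ^ (Nat.log 2 ⌊t⁻¹⌋₊ + 1) := by
  have h1 : ⌊t⁻¹⌋₊ + 1 ≤ 2 ^ (Nat.log 2 ⌊t⁻¹⌋₊ + 1) := Nat.lt_pow_succ_log_self one_lt_two _
  calc t⁻¹ < (⌊t⁻¹⌋₊ : ℝ) + 1 := Nat.lt_floor_add_one _
    _ = ((⌊t⁻¹⌋₊ + 1 : ℕ) : ℝ) := by push_cast; rfl
    _ ≤ ((2 ^ (Nat.log 2 ⌊t⁻¹⌋₊ + 1) : ℕ) : ℝ) := by exact_mod_cast h1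
    _ = (2 : ℝ) ^ (Nat.log 2 ⌊t⁻¹⌋₊ + 1) := by push_cast; rfl

/-- The dyadic mantissa `t * 2 ^ M` of `t ∈ (0, 1]`, `M = Nat.log 2 ⌊t⁻¹⌋₊`, lies in `[1/2, 1]`.
[folklore] -/
theorem mantissa_mem_Icc {t : ℝ} (ht : 0 < t) (ht1 : t ≤ 1) :
    t * 2 ^ Nat.log 2 ⌊t⁻¹⌋₊ ∈ Icc (1 / 2 : ℝ) 1 := by
  have h1 : t * 2 ^ Nat.log 2 ⌊t⁻¹⌋₊ ≤ t * t⁻¹ :=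
    mul_le_mul_of_nonneg_left (pow_log_floor_le_inv ht ht1) ht.le
  have h2 : t * t⁻¹ < t * 2 ^ (Nat.log 2 ⌊t⁻¹⌋₊ + 1) :=
    mul_lt_mul_of_pos_left (inv_lt_pow_log_floor_succ t) ht
  rw [mul_inv_cancel₀ ht.ne'] at h1 h2
  rw [pow_succ, ← mul_assoc] at h2
  exact ⟨by linarith, h1⟩

/-- The dyadic mantissa recovers `t`: `t * 2 ^ M / 2 ^ M = t`. [folklore] -/
theorem mantissa_div_pow (t : ℝ) (M : ℕ) : t * 2 ^ M / 2 ^ M = t :=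
  mul_div_cancel_right₀ t (pow_ne_zero M two_ne_zero)

/-- Along a sequence `v n → 0⁺` the dyadic exponents `Nat.log 2 ⌊(v n)⁻¹⌋₊` tend to infinity.
[folklore] -/
theorem tendsto_log_floor_inv_atTop {v : ℕ → ℝ} (hv : Tendsto v atTop (𝓝[>] (0 : ℝ))) :
    Tendsto (fun n => Nat.log 2 ⌊(v n)⁻¹⌋₊) atTop atTop := by
  have hfl : Tendsto (fun n => ⌊(v n)⁻¹⌋₊) atTop atTop :=
    tendsto_nat_floor_atTop.comp (tendsto_inv_nhdsGT_zero.comp hv)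
  refine tendsto_atTop_atTop.2 fun b => ?_
  obtain ⟨N, hN⟩ := tendsto_atTop_atTop.1 hfl (2 ^ b)
  exact ⟨N, fun n hn => Nat.le_log_of_pow_le one_lt_two (hN n hn)⟩

end MeshNormalForm

open MeshNormalForm in
/-- **Dyadic normal form of a mesh sequence** (registered support stub `stub_meshNormalForm` of
crux stmt-CriticalPhenomena-18183, line `Sketch`). Every real sequence `u n → 0⁺`
(`Tendsto u atTop (𝓝[>] 0)`: `u n → 0` and eventually `u n > 0`) has a subsequence `u ∘ ψ`
of the form `u (ψ n) = c n / 2 ^ (m n)` with `m : ℕ → ℕ` strictly increasing, all mantissae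
`c n ∈ [1/2, 1]`, and `c n → c₀ ∈ [1/2, 1]`. [folklore] -/
theorem stub_meshNormalForm : ∀ u : ℕ → ℝ, Tendsto u atTop (𝓝[>] (0 : ℝ)) →
    ∃ ψ : ℕ → ℕ, StrictMono ψ ∧ ∃ m : ℕ → ℕ, StrictMono m ∧ ∃ c : ℕ → ℝ, ∃ c₀ : ℝ,
      c₀ ∈ Set.Icc (1 / 2 : ℝ) 1 ∧ (∀ n, c n ∈ Set.Icc (1 / 2 : ℝ) 1) ∧
      Tendsto c atTop (𝓝 c₀) ∧ ∀ n, u (ψ n) = c n / 2 ^ (m n) := by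
  intro u hu
  -- (i) beyond `N₀` the sequence lies in `(0, 1]`; shift it there
  obtain ⟨hu0, hpos⟩ := tendsto_nhdsWithin_iff.1 hu
  have hle : ∀ᶠ n in atTop, u n ≤ 1 := hu0.eventually (eventually_le_nhds one_pos)
  obtain ⟨N₀, hN₀⟩ := eventually_atTop.1 (hpos.and hle)
  set v : ℕ → ℝ := fun n => u (n + N₀)
  have hv : ∀ n, 0 < v n ∧ v n ≤ 1 := fun n => hN₀ (n + N₀) (Nat.le_add_left N₀ n)
  have hv0 : Tendsto v atTop (𝓝[>] (0 : ℝ)) := hu.comp (tendsto_add_atTop_nat N₀)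
  -- (ii)-(iii) the dyadic exponents tend to infinity: extract strictly increasing exponents
  obtain ⟨φ₁, hφ₁, hMφ₁⟩ := strictMono_subseq_of_tendsto_atTop (tendsto_log_floor_inv_atTop hv0)
  -- (iv) Bolzano–Weierstrass on the mantissae in `[1/2, 1]`
  obtain ⟨c₀, hc₀, φ₂, hφ₂, hlim⟩ := isCompact_Icc.tendsto_subseq
    (x := fun n => v (φ₁ n) * 2 ^ Nat.log 2 ⌊(v (φ₁ n))⁻¹⌋₊)
    fun n => mantissa_mem_Icc (hv (φ₁ n)).1 (hv (φ₁ n)).2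
  -- (v) assemble: `ψ = N₀ + φ₁ ∘ φ₂`, exponents and mantissae along `φ₁ ∘ φ₂`
  refine ⟨fun n => φ₁ (φ₂ n) + N₀, fun a b hab => Nat.add_lt_add_right (hφ₁ (hφ₂ hab)) N₀,
    fun n => Nat.log 2 ⌊(v (φ₁ (φ₂ n)))⁻¹⌋₊, fun a b hab => hMφ₁ (hφ₂ hab),
    fun n => v (φ₁ (φ₂ n)) * 2 ^ Nat.log 2 ⌊(v (φ₁ (φ₂ n)))⁻¹⌋₊, c₀, hc₀,
    fun n => mantissa_mem_Icc (hv _).1 (hv _).2, hlim, fun n => ?_⟩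
  rw [mantissa_div_pow]
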